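import Summits.HodgeConjecture.HodgeConjecture.Theorems.A3Liu413StubFTF2iffOfFloor
import HarnessLib

/-!
# Label rigidity for WEIGHT-ONE oscillator labels of `V`'s own uniform family at an ARBITRARY scalar `a` — the `hsep` input of the
# MULT1 face bridge (director g4 RULING s73 (3) «O2»; A-p09's `A3Liu418Mult1AtFace`)

Topic: summit `HodgeConjecture`, sub-problem `HodgeConjecture`, route `HCCMUnconditional` (items stmt-HodgeConjecture-24832 hLiu418 / 24833 h413).
PROVER FILE (cell hodgecm-mathlib, D-0151; seat B-p14; `--supports stmt-HodgeConjecture-24832 --as helper`): theorems only, sorry-free, axioms ⊆ trio,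
namespace `Summit.HodgeConjecture.HodgeConjecture.Theorems`.  Sibling of ★ `A3Liu413StubFTF2iffOfFloor.sep_weightOne_datum413` (the pin, `a := repAt a₀ i.1`,
labels packaged as `P.Triple`): the SAME two engine calls (`Def411WeilCarriers.forall_localMu_eq_of_equiv_of_lemD1AsPrintedI` + weak approximation;
`Def411WeilCarriers.locF_eq_and_chi_eq_of_equiv_of_lemD1AsPrintedI`) at an arbitrary scalar `a : RealScalar F`, STRUCTURE-FREE (labels as components), on the
uniform family `𝕌ₐ = uniformOmegaRep … e₁ (frameD V) … (ιVE V) (2δ_K)⁻¹ (fun _ _ => rₐ)`, `rₐ = Rep.update Rep.ofLineOf (locF uₐ) uₐ rfl`, `uₐ = realUnit a`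
— so that `Lines.A3Liu418.UV hDel F V a Φ = muConj 𝕌ₐ` (A3Liu418Items :161) and the consumer relabels `μ ↦ μᶜ` itself.  Rows: [Lem. D.1 (1)] at every pair
and every scalar (★ `HypD1pp.lemD1AllPairs_of_facts … a …`), [Lem. D.1 (3)] on any indexed family (★ `lemD1_3AsPrintedI_famAtV_holds`).  Nothing of
[Liu2021] is asserted; HC_CM is proved only modulo the 7 printed citations until rung 0 closes.

Build-touch edition 2026-08-28T16:2xZ (director g6 RULING s81 (1); precedent p641946): no declaration changed — every declaration below is
byte-identical to the accepted tree bytes of p645003; this line only forces a rebuild of a stale olean.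

## References
* [Liu2021] Y. Liu, Camb. J. Math. 9 (2021) = arXiv:2102.11518: Def. 4.11–4.12, Thm. 4.18 (2) with proof l. 2270, App. D Lem. D.1 (1), (3).
* [FlathCorvallis1979] D. Flath, Corvallis (1979), Thm. 3.  [CasselsFrohlichANT1967] Ch. VII §8 (weak approximation).
-/

set_option autoImplicit false

-- `Summit.HodgeConjecture.HodgeConjecture.Theorems` is the mandated namespace (single-problem summit: Problem = Summit), which
-- `linter.dupNamespace` flags; the lakefile turns the linter off tree-wide (weak option), restated here so stand-alone elaboration is
-- warning-free too.
set_option linter.dupNamespace false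

noncomputable section

namespace Summit.HodgeConjecture.HodgeConjecture.Theorems

open scoped TensorProduct Matrix
open NumberField NumberField.InfinitePlace
open HodgeCM.Model HodgeCM.Model.LiuIndex HodgeCM.Model.TowerCarrier
open Summit.HodgeConjecture.CorCM
open Summit.HodgeConjecture.CorCM.Model
open Literature.AlgebraicGeometry.Motives (CMType)
open Literature.AlgebraicGeometry.HodgeTheory Literature.NumberTheory.Automorphic.PicardCM
open Literature.AlgebraicGeometry.ShimuraVarieties Literature.AlgebraicGeometry.ShimuraVarieties.UnitaryCanonicalModel
open Literature.NumberTheory.ComplexMultiplication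
open Literature.NumberTheory.Automorphic
open Literature.NumberTheory.Automorphic.IdeleClassGroup (toHeckeCharacter isUnitary_toHeckeCharacter galConj)
open Literature.NumberTheory.Automorphic.Liu2021 Literature.NumberTheory.Automorphic.Liu2021.AppendixC
open Literature.NumberTheory.Automorphic.Liu2021.AppendixC.RestOne
open Literature.NumberTheory.Automorphic.Liu2021.Def411WeilCarriers (lineOf locF Rep)
open Summit.HodgeConjecture.CorCM.Transposition.OmegaTransport (realUnit)
open HodgeCM.Model.ArchSideTerm (e₁)
open Literature.NumberTheory.GelbartRogawski1991 Literature.NumberTheory.GelbartRogawski1991.UnitaryDualPair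
open Literature.NumberTheory.GelbartRogawski1991.UnitaryDualPair.LocalSplitting (localMu norm_localMu continuous_localMu localMu_toLocalRing_eq_one_iff
  eq_of_forall_localMu_toHeckeCharacter_eq)
open Literature.RepresentationTheory Literature.RepresentationTheory.Liu2021
open Summit.HodgeConjecture.CorCM.Transposition
open Summit.HodgeConjecture.CorCM.Lines.A3Liu413
open Summit.HodgeConjecture.CorCM.D2Bridge.MuKeyIdentLemD3End
open scoped DirectSum

set_option synthInstance.maxHeartbeats 400000 in
set_option maxHeartbeats 8000000 in
/-- **Label rigidity for WEIGHT-ONE labels at an arbitrary scalar `a`** ([Liu2021, Thm. 4.18 (2)] «follows from Lemma D.1», l. 2270, for `V`'s own uniform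
family `𝕌ₐ`): two weight-one conjugate-symplectic labels `(μ₁, ε₁, χ₁)`, `(μ₂, ε₂, χ₂)` with `ω(μ₁, ε₁, χ₁) ≠ 0` and a `U(V)(𝔸_{F⁺,f})`-equivariant `ℂ`-linear
`ω(μ₁, ε₁, χ₁) ≃ ω(μ₂, ε₂, χ₂)` have `μ₁ = μ₂`, `ε`-LINES in the same local norm class everywhere (`locF (rₐ ε₁) = locF (rₐ ε₂)`) and `χ₁ = χ₂` — admissible OR NOT.
The engines of `Lines.A3Liu413.sep_admTriple_uniformOmegaRep_of_lemD1AsPrinted` on the index family of ALL weight-one labels, rows closed by name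
(`HypD1pp.lemD1AllPairs_of_facts` at scalar `a`; `lemD1_3AsPrintedI_famAtV_holds`).  The `ε`-labels themselves agree once both lines are honest
(`eps_eq_of_sep_weightOne_at`).  HC_CM is proved only modulo the 7 printed citations.
[cite: Liu2021, Thm. 4.18 (2) (l. 2241) with proof l. 2270; App. D Lemma D.1 (1), (3) (l. 5229, 5233); Def. 4.11–4.12]
[cite: FlathCorvallis1979, Theorem 3 (uniqueness clause)] [cite: CasselsFrohlichANT1967, Ch. VII §8] -/
theorem sep_weightOne_at
    (hDel : Literature.AlgebraicGeometry.ShimuraVarieties.UnitaryCanonicalModel.canonicalModel_exists_printed)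
    (F : HodgeCM.CMField) [IsGalois ℚ F] (h6 : 6 ≤ Module.finrank ℚ F) {ι₁ : F →+* ℂ} (V : HodgeCM.HermSpace3 F ι₁) (a : RealScalar F)
    (Φ : CMType F) (hΦ : ι₁ ∈ Φ.1)
    (μ₁ μ₂ : Literature.NumberTheory.Automorphic.IdeleClassGroup (F : Type) →ₜ* Circle)
    (h₁ : IdeleClassGroup.IsConjugateSymplectic (F : Type) μ₁) (h₂ : IdeleClassGroup.IsConjugateSymplectic (F : Type) μ₂)
    (hw₁ : IdeleClassGroup.HasWeight (F : Type) μ₁ 1) (hw₂ : IdeleClassGroup.HasWeight (F : Type) μ₂ 1)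
    (ε₁ ε₂ : Def411WeilCarriers.Eps ↥(maximalRealSubfield (HodgeCM.CMField.K F)) (imagUnitSq (HodgeCM.CMField.K F)))
    (χ₁ χ₂ : Def411WeilCarriers.Chi ↥(maximalRealSubfield (HodgeCM.CMField.K F)) (HodgeCM.CMField.K F) (IsCMField.complexConj (HodgeCM.CMField.K F)))
    (hs : Nontrivial ((uniformOmegaRep (Summit.HodgeConjecture.CorCM.DelRec.exists_recordSystem_of_printed hDel) ⟨HodgeCM.CMField.K F⟩ ι₁ ⟨HodgeCM.HermSpace3.Hm V, HodgeCM.HermSpace3.isHermitian V, HodgeCM.HermSpace3.signature_ι₁ V, HodgeCM.HermSpace3.posDef_of_ne V⟩ Φ e₁ (frameD V) (frameD_real V) (frameD_ne V) (ιVE V) (2 * imagUnit (HodgeCM.CMField.K F))⁻¹ (fun _ _ => (Rep.update ↥(maximalRealSubfield (HodgeCM.CMField.K F)) (imagUnitSq (HodgeCM.CMField.K F)) (Rep.ofLineOf ↥(maximalRealSubfield (HodgeCM.CMField.K F)) (imagUnitSq (HodgeCM.CMField.K F))) (locF ↥(maximalRealSubfield (HodgeCM.CMField.K F)) (imagUnitSq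 (HodgeCM.CMField.K F)) (realUnit ⟨HodgeCM.CMField.K F⟩ a.1 a.2.1 a.2.2)) (realUnit ⟨HodgeCM.CMField.K F⟩ a.1 a.2.1 a.2.2) rfl))).omega μ₁ h₁ ε₁ χ₁))
    (hst : ∃ f : (uniformOmegaRep (Summit.HodgeConjecture.CorCM.DelRec.exists_recordSystem_of_printed hDel) ⟨HodgeCM.CMField.K F⟩ ι₁ ⟨HodgeCM.HermSpace3.Hm V, HodgeCM.HermSpace3.isHermitian V, HodgeCM.HermSpace3.signature_ι₁ V, HodgeCM.HermSpace3.posDef_of_ne V⟩ Φ e₁ (frameD V) (frameD_real V) (frameD_ne V) (ιVE V) (2 * imagUnit (HodgeCM.CMField.K F))⁻¹ (fun _ _ => (Rep.update ↥(maximalRealSubfield (HodgeCM.CMField.K F)) (imagUnitSq (HodgeCM.CMField.K F)) (Rep.ofLineOf ↥(maximalRealSubfield (HodgeCM.CMField.K F)) (imagUnitSq (HodgeCM.CMField.K F))) (locF ↥(maximalRealSubfield (HodgeCM.CMField.K F)) (imagUnitSq (HodgeCM.CMField.K F)) (realUnit ⟨HodgeCM.CMField.K F⟩ a.1 a.2.1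 a.2.2)) (realUnit ⟨HodgeCM.CMField.K F⟩ a.1 a.2.1 a.2.2) rfl))).omega μ₁ h₁ ε₁ χ₁ ≃ₗ[ℂ] (uniformOmegaRep (Summit.HodgeConjecture.CorCM.DelRec.exists_recordSystem_of_printed hDel) ⟨HodgeCM.CMField.K F⟩ ι₁ ⟨HodgeCM.HermSpace3.Hm V, HodgeCM.HermSpace3.isHermitian V, HodgeCM.HermSpace3.signature_ι₁ V, HodgeCM.HermSpace3.posDef_of_ne V⟩ Φ e₁ (frameD V) (frameD_real V) (frameD_ne V) (ιVE V) (2 * imagUnit (HodgeCM.CMField.K F))⁻¹ (fun _ _ => (Rep.update ↥(maximalRealSubfield (HodgeCM.CMField.K F)) (imagUnitSq (HodgeCM.CMField.K F)) (Rep.ofLineOf ↥(maximalRealSubfield (HodgeCM.CMField.K F)) (imagUnitSq (HodgeCM.CMField.K F))) (locF ↥(maximalRealSubfield (HodgeCM.CMField.K F)) (imagUnitSq (HodgeCM.CMField.K F)) (realUnit ⟨HodgeCM.CMField.K F⟩ a.1 a.2.1 a.2.2)) (realUnit ⟨HodgeCM.CMField.K F⟩ a.1 a.2.1 a.2.2)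 rfl))).omega μ₂ h₂ ε₂ χ₂,
      ∀ (g : (sec42DataOf (Summit.HodgeConjecture.CorCM.DelRec.exists_recordSystem_of_printed hDel) isoOf ⟨HodgeCM.CMField.K F⟩ ι₁
          ⟨HodgeCM.HermSpace3.Hm V, HodgeCM.HermSpace3.isHermitian V, HodgeCM.HermSpace3.signature_ι₁ V, HodgeCM.HermSpace3.posDef_of_ne V⟩ Φ).G)
        (x : (uniformOmegaRep (Summit.HodgeConjecture.CorCM.DelRec.exists_recordSystem_of_printed hDel) ⟨HodgeCM.CMField.K F⟩ ι₁ ⟨HodgeCM.HermSpace3.Hm V, HodgeCM.HermSpace3.isHermitian V, HodgeCM.HermSpace3.signature_ι₁ V, HodgeCM.HermSpace3.posDef_of_ne V⟩ Φ e₁ (frameD V) (frameD_real V) (frameD_ne V) (ιVE V) (2 * imagUnit (HodgeCM.CMField.K F))⁻¹ (fun _ _ => (Rep.update ↥(maximalRealSubfield (HodgeCM.CMField.K F)) (imagUnitSq (HodgeCM.CMField.K F)) (Rep.ofLineOf ↥(maximalRealSubfield (HodgeCM.CMField.K F)) (imagUnitSq (HodgeCM.CMField.K F))) (locF ↥(maximalRealSubfield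 (HodgeCM.CMField.K F)) (imagUnitSq (HodgeCM.CMField.K F)) (realUnit ⟨HodgeCM.CMField.K F⟩ a.1 a.2.1 a.2.2)) (realUnit ⟨HodgeCM.CMField.K F⟩ a.1 a.2.1 a.2.2) rfl))).omega μ₁ h₁ ε₁ χ₁), f ((uniformOmegaRep (Summit.HodgeConjecture.CorCM.DelRec.exists_recordSystem_of_printed hDel) ⟨HodgeCM.CMField.K F⟩ ι₁ ⟨HodgeCM.HermSpace3.Hm V, HodgeCM.HermSpace3.isHermitian V, HodgeCM.HermSpace3.signature_ι₁ V, HodgeCM.HermSpace3.posDef_of_ne V⟩ Φ e₁ (frameD V) (frameD_real V) (frameD_ne V) (ιVE V) (2 * imagUnit (HodgeCM.CMField.K F))⁻¹ (fun _ _ => (Rep.update ↥(maximalRealSubfield (HodgeCM.CMField.K F)) (imagUnitSq (HodgeCM.CMField.K F)) (Rep.ofLineOf ↥(maximalRealSubfield (HodgeCM.CMField.K F)) (imagUnitSq (HodgeCM.CMField.K F))) (locF ↥(maximalRealSubfield (HodgeCM.CMField.K F)) (imagUnitSq (HodgeCM.CMField.K F)) (realUnit ⟨HodgeCM.CMField.K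 F⟩ a.1 a.2.1 a.2.2)) (realUnit ⟨HodgeCM.CMField.K F⟩ a.1 a.2.1 a.2.2) rfl))).rho μ₁ h₁ ε₁ χ₁ g x) = (uniformOmegaRep (Summit.HodgeConjecture.CorCM.DelRec.exists_recordSystem_of_printed hDel) ⟨HodgeCM.CMField.K F⟩ ι₁ ⟨HodgeCM.HermSpace3.Hm V, HodgeCM.HermSpace3.isHermitian V, HodgeCM.HermSpace3.signature_ι₁ V, HodgeCM.HermSpace3.posDef_of_ne V⟩ Φ e₁ (frameD V) (frameD_real V) (frameD_ne V) (ιVE V) (2 * imagUnit (HodgeCM.CMField.K F))⁻¹ (fun _ _ => (Rep.update ↥(maximalRealSubfield (HodgeCM.CMField.K F)) (imagUnitSq (HodgeCM.CMField.K F)) (Rep.ofLineOf ↥(maximalRealSubfield (HodgeCM.CMField.K F)) (imagUnitSq (HodgeCM.CMField.K F))) (locF ↥(maximalRealSubfield (HodgeCM.CMField.K F)) (imagUnitSq (HodgeCM.CMField.K F)) (realUnit ⟨HodgeCM.CMField.K F⟩ a.1 a.2.1 a.2.2)) (realUnit ⟨HodgeCM.CMField.K F⟩ a.1 a.2.1 a.2.2)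 rfl))).rho μ₂ h₂ ε₂ χ₂ g (f x)) :
    μ₁ = μ₂ ∧
      locF ↥(maximalRealSubfield (HodgeCM.CMField.K F)) (imagUnitSq (HodgeCM.CMField.K F)) ((Rep.update ↥(maximalRealSubfield (HodgeCM.CMField.K F)) (imagUnitSq (HodgeCM.CMField.K F)) (Rep.ofLineOf ↥(maximalRealSubfield (HodgeCM.CMField.K F)) (imagUnitSq (HodgeCM.CMField.K F))) (locF ↥(maximalRealSubfield (HodgeCM.CMField.K F)) (imagUnitSq (HodgeCM.CMField.K F)) (realUnit ⟨HodgeCM.CMField.K F⟩ a.1 a.2.1 a.2.2)) (realUnit ⟨HodgeCM.CMField.K F⟩ a.1 a.2.1 a.2.2) rfl).toFun ε₁) =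
        locF ↥(maximalRealSubfield (HodgeCM.CMField.K F)) (imagUnitSq (HodgeCM.CMField.K F)) ((Rep.update ↥(maximalRealSubfield (HodgeCM.CMField.K F)) (imagUnitSq (HodgeCM.CMField.K F)) (Rep.ofLineOf ↥(maximalRealSubfield (HodgeCM.CMField.K F)) (imagUnitSq (HodgeCM.CMField.K F))) (locF ↥(maximalRealSubfield (HodgeCM.CMField.K F)) (imagUnitSq (HodgeCM.CMField.K F)) (realUnit ⟨HodgeCM.CMField.K F⟩ a.1 a.2.1 a.2.2)) (realUnit ⟨HodgeCM.CMField.K F⟩ a.1 a.2.1 a.2.2) rfl).toFun ε₂) ∧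
      χ₁ = χ₂ := by
  -- the `μ`-leg on the WEIGHT-ONE label family at scalar `a`, then weak approximation
  have keyμ := Def411WeilCarriers.forall_localMu_eq_of_equiv_of_lemD1AsPrintedI (ι := {q : (Literature.NumberTheory.Automorphic.IdeleClassGroup (F : Type) →ₜ* Circle) × Def411WeilCarriers.Eps ↥(maximalRealSubfield (HodgeCM.CMField.K F)) (imagUnitSq (HodgeCM.CMField.K F)) × Def411WeilCarriers.Chi ↥(maximalRealSubfield (HodgeCM.CMField.K F)) (HodgeCM.CMField.K F) (IsCMField.complexConj (HodgeCM.CMField.K F)) // IdeleClassGroup.IsConjugateSymplectic (F : Type) q.1 ∧ IdeleClassGroup.HasWeight (F : Type) q.1 1})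
      ↥(maximalRealSubfield (F : Type)) (F : Type) (IsCMField.complexConj (F : Type)) 3 e₁ (Matrix.diagonal (frameD V))
      (complexConj_imagUnit (F : Type)) (imagUnit_ne_zero (F : Type)) (imagUnit_mul_self (F : Type))
      (realDiagonal_isSymm (F : Type) (frameD V) (frameD_real V)) (isUnit_det_realDiagonal (F : Type) (frameD V) (frameD_real V) (frameD_ne V))
      (realDiagonal_map (F : Type) (frameD V) (frameD_real V)).symm (le_refl 3)
      (fun k => (Rep.update ↥(maximalRealSubfield (HodgeCM.CMField.K F)) (imagUnitSq (HodgeCM.CMField.K F)) (Rep.ofLineOf ↥(maximalRealSubfield (HodgeCM.CMField.K F)) (imagUnitSq (HodgeCM.CMField.K F))) (locF ↥(maximalRealSubfield (HodgeCM.CMField.K F)) (imagUnitSq (HodgeCM.CMField.K F)) (realUnit ⟨HodgeCM.CMField.K F⟩ a.1 a.2.1 a.2.2)) (realUnit ⟨HodgeCM.CMField.K F⟩ a.1 a.2.1 a.2.2) rfl).toFun k.1.2.1) (fun k => k.1.2.2)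
      (fun k => OmegaChiSplitting.chiLocalSplittingsD ⟨HodgeCM.CMField.K F⟩ e₁ (frameD V) (frameD_real V) (frameD_ne V) (toHeckeCharacter (F : Type) k.1.1)
        ((isOscillatorChar_toHeckeCharacter_iff k.1.1).mpr k.2.1) ((Rep.update ↥(maximalRealSubfield (HodgeCM.CMField.K F)) (imagUnitSq (HodgeCM.CMField.K F)) (Rep.ofLineOf ↥(maximalRealSubfield (HodgeCM.CMField.K F)) (imagUnitSq (HodgeCM.CMField.K F))) (locF ↥(maximalRealSubfield (HodgeCM.CMField.K F)) (imagUnitSq (HodgeCM.CMField.K F)) (realUnit ⟨HodgeCM.CMField.K F⟩ a.1 a.2.1 a.2.2)) (realUnit ⟨HodgeCM.CMField.K F⟩ a.1 a.2.1 a.2.2) rfl).toFun k.1.2.1))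
      (fun k => localMu (F : Type) (toHeckeCharacter (F : Type) k.1.1))
      (fun k v x => norm_localMu (F : Type) (toHeckeCharacter (F : Type) k.1.1) v (isUnitary_toHeckeCharacter (F : Type) k.1.1) x)
      (fun k => continuous_localMu (F : Type) (toHeckeCharacter (F : Type) k.1.1))
      (fun k v x => localMu_toLocalRing_eq_one_iff (F : Type) (toHeckeCharacter (F : Type) k.1.1) v
        ((isOscillatorChar_toHeckeCharacter_iff k.1.1).mpr k.2.1) x)
      (fun k b => OmegaChiSplitting.hsChiD ⟨HodgeCM.CMField.K F⟩ e₁ (frameD V) (frameD_real V) (frameD_ne V) (toHeckeCharacter (F : Type) k.1.1)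
        (isUnitary_toHeckeCharacter (F : Type) k.1.1) ((isOscillatorChar_toHeckeCharacter_iff k.1.1).mpr k.2.1) b)
      (fun k => OmegaChiSplitting.hfac_sChiD ⟨HodgeCM.CMField.K F⟩ e₁ (frameD V) (frameD_real V) (frameD_ne V) (toHeckeCharacter (F : Type) k.1.1)
        (isUnitary_toHeckeCharacter (F : Type) k.1.1) ((isOscillatorChar_toHeckeCharacter_iff k.1.1).mpr k.2.1) ((Rep.update ↥(maximalRealSubfield (HodgeCM.CMField.K F)) (imagUnitSq (HodgeCM.CMField.K F)) (Rep.ofLineOf ↥(maximalRealSubfield (HodgeCM.CMField.K F)) (imagUnitSq (HodgeCM.CMField.K F))) (locF ↥(maximalRealSubfield (HodgeCM.CMField.K F)) (imagUnitSq (HodgeCM.CMField.K F)) (realUnit ⟨HodgeCM.CMField.K F⟩ a.1 a.2.1 a.2.2)) (realUnit ⟨HodgeCM.CMField.K F⟩ a.1 a.2.1 a.2.2) rfl).toFun k.1.2.1))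
      (fun k v => Summit.HodgeConjecture.CorCM.HypD1pp.lemD1AllPairs_of_facts
        Literature.RepresentationTheory.MoeglinVignerasWaldspurger1987.mvw_IV4_rankOne_irreducibleOrZero_holds
        Literature.NumberTheory.Automorphic.Liu2021.splitPlace_chiCoinv_iso_parabolicIndGL_holds
        Literature.NumberTheory.Automorphic.Zelevinsky1980.parabolicIndGL_detChar_unitary_isIrreducible_holds.{0}
        hDel F h6 V a Φ hΦ k.1.1 k.2.1 k.2.2 k.1.2.1 k.1.2.2 v)
      (fun v => lemD1_3AsPrintedI_famAtV_holds F (frameD V) (frameD_real V) (frameD_ne V)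
        (fun k : {q : (Literature.NumberTheory.Automorphic.IdeleClassGroup (F : Type) →ₜ* Circle) × Def411WeilCarriers.Eps ↥(maximalRealSubfield (HodgeCM.CMField.K F)) (imagUnitSq (HodgeCM.CMField.K F)) × Def411WeilCarriers.Chi ↥(maximalRealSubfield (HodgeCM.CMField.K F)) (HodgeCM.CMField.K F) (IsCMField.complexConj (HodgeCM.CMField.K F)) // IdeleClassGroup.IsConjugateSymplectic (F : Type) q.1 ∧ IdeleClassGroup.HasWeight (F : Type) q.1 1} => k.1.1) (fun k => k.2.1)
        (fun k => (Rep.update ↥(maximalRealSubfield (HodgeCM.CMField.K F)) (imagUnitSq (HodgeCM.CMField.K F)) (Rep.ofLineOf ↥(maximalRealSubfield (HodgeCM.CMField.K F)) (imagUnitSq (HodgeCM.CMField.K F))) (locF ↥(maximalRealSubfield (HodgeCM.CMField.K F)) (imagUnitSq (HodgeCM.CMField.K F)) (realUnit ⟨HodgeCM.CMField.K F⟩ a.1 a.2.1 a.2.2)) (realUnit ⟨HodgeCM.CMField.K F⟩ a.1 a.2.1 a.2.2) rfl).toFun k.1.2.1) (fun k => k.1.2.2) v)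
      (UnitaryDualPair.finPart_cmKTypeHom_finAdelicToAdelic_surjective (F : Type) V.Hm (frameG V) (frameD V) (frame_congr V))
      ⟨(μ₁, ε₁, χ₁), h₁, hw₁⟩ ⟨(μ₂, ε₂, χ₂), h₂, hw₂⟩ hs hst
  -- the `ε`- and `χ`-legs on the same family
  have key2 := Def411WeilCarriers.locF_eq_and_chi_eq_of_equiv_of_lemD1AsPrintedI (ι := {q : (Literature.NumberTheory.Automorphic.IdeleClassGroup (F : Type) →ₜ* Circle) × Def411WeilCarriers.Eps ↥(maximalRealSubfield (HodgeCM.CMField.K F)) (imagUnitSq (HodgeCM.CMField.K F)) × Def411WeilCarriers.Chi ↥(maximalRealSubfield (HodgeCM.CMField.K F)) (HodgeCM.CMField.K F) (IsCMField.complexConj (HodgeCM.CMField.K F)) // IdeleClassGroup.IsConjugateSymplectic (F : Type) q.1 ∧ IdeleClassGroup.HasWeight (F : Type) q.1 1})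
      ↥(maximalRealSubfield (F : Type)) (F : Type) (IsCMField.complexConj (F : Type)) 3 (Matrix.diagonal (frameD V))
      (complexConj_imagUnit (F : Type)) (imagUnit_ne_zero (F : Type)) e₁ (imagUnit_mul_self (F : Type))
      (realDiagonal_isSymm (F : Type) (frameD V) (frameD_real V)) (isUnit_det_realDiagonal (F : Type) (frameD V) (frameD_real V) (frameD_ne V))
      (realDiagonal_map (F : Type) (frameD V) (frameD_real V)).symm (le_refl 3)
      (fun k => (Rep.update ↥(maximalRealSubfield (HodgeCM.CMField.K F)) (imagUnitSq (HodgeCM.CMField.K F)) (Rep.ofLineOf ↥(maximalRealSubfield (HodgeCM.CMField.K F)) (imagUnitSq (HodgeCM.CMField.K F))) (locF ↥(maximalRealSubfield (HodgeCM.CMField.K F)) (imagUnitSq (HodgeCM.CMField.K F)) (realUnit ⟨HodgeCM.CMField.K F⟩ a.1 a.2.1 a.2.2)) (realUnit ⟨HodgeCM.CMField.K F⟩ a.1 a.2.1 a.2.2) rfl).toFun k.1.2.1) (fun k => k.1.2.2)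
      (fun k => OmegaChiSplitting.chiLocalSplittingsD ⟨HodgeCM.CMField.K F⟩ e₁ (frameD V) (frameD_real V) (frameD_ne V) (toHeckeCharacter (F : Type) k.1.1)
        ((isOscillatorChar_toHeckeCharacter_iff k.1.1).mpr k.2.1) ((Rep.update ↥(maximalRealSubfield (HodgeCM.CMField.K F)) (imagUnitSq (HodgeCM.CMField.K F)) (Rep.ofLineOf ↥(maximalRealSubfield (HodgeCM.CMField.K F)) (imagUnitSq (HodgeCM.CMField.K F))) (locF ↥(maximalRealSubfield (HodgeCM.CMField.K F)) (imagUnitSq (HodgeCM.CMField.K F)) (realUnit ⟨HodgeCM.CMField.K F⟩ a.1 a.2.1 a.2.2)) (realUnit ⟨HodgeCM.CMField.K F⟩ a.1 a.2.1 a.2.2) rfl).toFun k.1.2.1))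
      (fun k => localMu (F : Type) (toHeckeCharacter (F : Type) k.1.1))
      (fun k v x => norm_localMu (F : Type) (toHeckeCharacter (F : Type) k.1.1) v (isUnitary_toHeckeCharacter (F : Type) k.1.1) x)
      (fun k => continuous_localMu (F : Type) (toHeckeCharacter (F : Type) k.1.1))
      (fun k v x => localMu_toLocalRing_eq_one_iff (F : Type) (toHeckeCharacter (F : Type) k.1.1) v
        ((isOscillatorChar_toHeckeCharacter_iff k.1.1).mpr k.2.1) x)
      (fun k b => OmegaChiSplitting.hsChiD ⟨HodgeCM.CMField.K F⟩ e₁ (frameD V) (frameD_real V) (frameD_ne V) (toHeckeCharacter (F : Type) k.1.1)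
        (isUnitary_toHeckeCharacter (F : Type) k.1.1) ((isOscillatorChar_toHeckeCharacter_iff k.1.1).mpr k.2.1) b)
      (fun k => OmegaChiSplitting.hfac_sChiD ⟨HodgeCM.CMField.K F⟩ e₁ (frameD V) (frameD_real V) (frameD_ne V) (toHeckeCharacter (F : Type) k.1.1)
        (isUnitary_toHeckeCharacter (F : Type) k.1.1) ((isOscillatorChar_toHeckeCharacter_iff k.1.1).mpr k.2.1) ((Rep.update ↥(maximalRealSubfield (HodgeCM.CMField.K F)) (imagUnitSq (HodgeCM.CMField.K F)) (Rep.ofLineOf ↥(maximalRealSubfield (HodgeCM.CMField.K F)) (imagUnitSq (HodgeCM.CMField.K F))) (locF ↥(maximalRealSubfield (HodgeCM.CMField.K F)) (imagUnitSq (HodgeCM.CMField.K F)) (realUnit ⟨HodgeCM.CMField.K F⟩ a.1 a.2.1 a.2.2)) (realUnit ⟨HodgeCM.CMField.K F⟩ a.1 a.2.1 a.2.2) rfl).toFun k.1.2.1))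
      (fun k v => Summit.HodgeConjecture.CorCM.HypD1pp.lemD1AllPairs_of_facts
        Literature.RepresentationTheory.MoeglinVignerasWaldspurger1987.mvw_IV4_rankOne_irreducibleOrZero_holds
        Literature.NumberTheory.Automorphic.Liu2021.splitPlace_chiCoinv_iso_parabolicIndGL_holds
        Literature.NumberTheory.Automorphic.Zelevinsky1980.parabolicIndGL_detChar_unitary_isIrreducible_holds.{0}
        hDel F h6 V a Φ hΦ k.1.1 k.2.1 k.2.2 k.1.2.1 k.1.2.2 v)
      (fun v => lemD1_3AsPrintedI_famAtV_holds F (frameD V) (frameD_real V) (frameD_ne V)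
        (fun k : {q : (Literature.NumberTheory.Automorphic.IdeleClassGroup (F : Type) →ₜ* Circle) × Def411WeilCarriers.Eps ↥(maximalRealSubfield (HodgeCM.CMField.K F)) (imagUnitSq (HodgeCM.CMField.K F)) × Def411WeilCarriers.Chi ↥(maximalRealSubfield (HodgeCM.CMField.K F)) (HodgeCM.CMField.K F) (IsCMField.complexConj (HodgeCM.CMField.K F)) // IdeleClassGroup.IsConjugateSymplectic (F : Type) q.1 ∧ IdeleClassGroup.HasWeight (F : Type) q.1 1} => k.1.1) (fun k => k.2.1)
        (fun k => (Rep.update ↥(maximalRealSubfield (HodgeCM.CMField.K F)) (imagUnitSq (HodgeCM.CMField.K F)) (Rep.ofLineOf ↥(maximalRealSubfield (HodgeCM.CMField.K F)) (imagUnitSq (HodgeCM.CMField.K F))) (locF ↥(maximalRealSubfield (HodgeCM.CMField.K F)) (imagUnitSq (HodgeCM.CMField.K F)) (realUnit ⟨HodgeCM.CMField.K F⟩ a.1 a.2.1 a.2.2)) (realUnit ⟨HodgeCM.CMField.K F⟩ a.1 a.2.1 a.2.2) rfl).toFun k.1.2.1) (fun k => k.1.2.2) v)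
      (UnitaryDualPair.finPart_cmKTypeHom_finAdelicToAdelic_surjective (F : Type) V.Hm (frameG V) (frameD V) (frame_congr V))
      ⟨(μ₁, ε₁, χ₁), h₁, hw₁⟩ ⟨(μ₂, ε₂, χ₂), h₂, hw₂⟩ hs hst
  exact ⟨eq_of_forall_localMu_toHeckeCharacter_eq (F : Type) μ₁ μ₂ keyμ, key2.1, key2.2⟩

set_option synthInstance.maxHeartbeats 400000 in
set_option maxHeartbeats 8000000 in
/-- **… hence equal labels when both `ε`-lines are honest** (`locF b = ε` for some global `b` — e.g. `ε` admissible, `Def411WeilCarriers.exists_locF_eq_epsOf`,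
or cofinite, B-p04's `exists_prescribed_normClass_of_finite`): the section `rₐ` recovers honest collections (`Rep.locF_toFun`). [cite: Liu2021, Def. 4.12 (l. 2105); Thm. 4.18 (2)] -/
theorem eps_eq_of_sep_weightOne_at
    (hDel : Literature.AlgebraicGeometry.ShimuraVarieties.UnitaryCanonicalModel.canonicalModel_exists_printed)
    (F : HodgeCM.CMField) [IsGalois ℚ F] (h6 : 6 ≤ Module.finrank ℚ F) {ι₁ : F →+* ℂ} (V : HodgeCM.HermSpace3 F ι₁) (a : RealScalar F)
    (Φ : CMType F) (hΦ : ι₁ ∈ Φ.1)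
    (μ₁ μ₂ : Literature.NumberTheory.Automorphic.IdeleClassGroup (F : Type) →ₜ* Circle)
    (h₁ : IdeleClassGroup.IsConjugateSymplectic (F : Type) μ₁) (h₂ : IdeleClassGroup.IsConjugateSymplectic (F : Type) μ₂)
    (hw₁ : IdeleClassGroup.HasWeight (F : Type) μ₁ 1) (hw₂ : IdeleClassGroup.HasWeight (F : Type) μ₂ 1)
    (ε₁ ε₂ : Def411WeilCarriers.Eps ↥(maximalRealSubfield (HodgeCM.CMField.K F)) (imagUnitSq (HodgeCM.CMField.K F)))
    (χ₁ χ₂ : Def411WeilCarriers.Chi ↥(maximalRealSubfield (HodgeCM.CMField.K F)) (HodgeCM.CMField.K F) (IsCMField.complexConj (HodgeCM.CMField.K F)))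
    (hε₁ : ∃ b : (↥(maximalRealSubfield (HodgeCM.CMField.K F)))ˣ, locF ↥(maximalRealSubfield (HodgeCM.CMField.K F)) (imagUnitSq (HodgeCM.CMField.K F)) b = ε₁)
    (hε₂ : ∃ b : (↥(maximalRealSubfield (HodgeCM.CMField.K F)))ˣ, locF ↥(maximalRealSubfield (HodgeCM.CMField.K F)) (imagUnitSq (HodgeCM.CMField.K F)) b = ε₂)
    (hs : Nontrivial ((uniformOmegaRep (Summit.HodgeConjecture.CorCM.DelRec.exists_recordSystem_of_printed hDel) ⟨HodgeCM.CMField.K F⟩ ι₁ ⟨HodgeCM.HermSpace3.Hm V, HodgeCM.HermSpace3.isHermitian V, HodgeCM.HermSpace3.signature_ι₁ V, HodgeCM.HermSpace3.posDef_of_ne V⟩ Φ e₁ (frameD V) (frameD_real V) (frameD_ne V) (ιVE V) (2 * imagUnit (HodgeCM.CMField.K F))⁻¹ (fun _ _ => (Rep.update ↥(maximalRealSubfield (HodgeCM.CMField.K F)) (imagUnitSq (HodgeCM.CMField.K F)) (Rep.ofLineOf ↥(maximalRealSubfield (HodgeCM.CMField.K F)) (imagUnitSq (HodgeCM.CMField.K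 F))) (locF ↥(maximalRealSubfield (HodgeCM.CMField.K F)) (imagUnitSq (HodgeCM.CMField.K F)) (realUnit ⟨HodgeCM.CMField.K F⟩ a.1 a.2.1 a.2.2)) (realUnit ⟨HodgeCM.CMField.K F⟩ a.1 a.2.1 a.2.2) rfl))).omega μ₁ h₁ ε₁ χ₁))
    (hst : ∃ f : (uniformOmegaRep (Summit.HodgeConjecture.CorCM.DelRec.exists_recordSystem_of_printed hDel) ⟨HodgeCM.CMField.K F⟩ ι₁ ⟨HodgeCM.HermSpace3.Hm V, HodgeCM.HermSpace3.isHermitian V, HodgeCM.HermSpace3.signature_ι₁ V, HodgeCM.HermSpace3.posDef_of_ne V⟩ Φ e₁ (frameD V) (frameD_real V) (frameD_ne V) (ιVE V) (2 * imagUnit (HodgeCM.CMField.K F))⁻¹ (fun _ _ => (Rep.update ↥(maximalRealSubfield (HodgeCM.CMField.K F)) (imagUnitSq (HodgeCM.CMField.K F)) (Rep.ofLineOf ↥(maximalRealSubfield (HodgeCM.CMField.K F)) (imagUnitSq (HodgeCM.CMField.K F))) (locF ↥(maximalRealSubfield (HodgeCM.CMField.K F)) (imagUnitSq (HodgeCM.CMField.K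 F)) (realUnit ⟨HodgeCM.CMField.K F⟩ a.1 a.2.1 a.2.2)) (realUnit ⟨HodgeCM.CMField.K F⟩ a.1 a.2.1 a.2.2) rfl))).omega μ₁ h₁ ε₁ χ₁ ≃ₗ[ℂ] (uniformOmegaRep (Summit.HodgeConjecture.CorCM.DelRec.exists_recordSystem_of_printed hDel) ⟨HodgeCM.CMField.K F⟩ ι₁ ⟨HodgeCM.HermSpace3.Hm V, HodgeCM.HermSpace3.isHermitian V, HodgeCM.HermSpace3.signature_ι₁ V, HodgeCM.HermSpace3.posDef_of_ne V⟩ Φ e₁ (frameD V) (frameD_real V) (frameD_ne V) (ιVE V) (2 * imagUnit (HodgeCM.CMField.K F))⁻¹ (fun _ _ => (Rep.update ↥(maximalRealSubfield (HodgeCM.CMField.K F)) (imagUnitSq (HodgeCM.CMField.K F)) (Rep.ofLineOf ↥(maximalRealSubfield (HodgeCM.CMField.K F)) (imagUnitSq (HodgeCM.CMField.K F))) (locF ↥(maximalRealSubfield (HodgeCM.CMField.K F)) (imagUnitSq (HodgeCM.CMField.K F)) (realUnit ⟨HodgeCM.CMField.K F⟩ a.1 a.2.1 a.2.2)) (realUnit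 ⟨HodgeCM.CMField.K F⟩ a.1 a.2.1 a.2.2) rfl))).omega μ₂ h₂ ε₂ χ₂,
      ∀ (g : (sec42DataOf (Summit.HodgeConjecture.CorCM.DelRec.exists_recordSystem_of_printed hDel) isoOf ⟨HodgeCM.CMField.K F⟩ ι₁
          ⟨HodgeCM.HermSpace3.Hm V, HodgeCM.HermSpace3.isHermitian V, HodgeCM.HermSpace3.signature_ι₁ V, HodgeCM.HermSpace3.posDef_of_ne V⟩ Φ).G)
        (x : (uniformOmegaRep (Summit.HodgeConjecture.CorCM.DelRec.exists_recordSystem_of_printed hDel) ⟨HodgeCM.CMField.K F⟩ ι₁ ⟨HodgeCM.HermSpace3.Hm V, HodgeCM.HermSpace3.isHermitian V, HodgeCM.HermSpace3.signature_ι₁ V, HodgeCM.HermSpace3.posDef_of_ne V⟩ Φ e₁ (frameD V) (frameD_real V) (frameD_ne V) (ιVE V) (2 * imagUnit (HodgeCM.CMField.K F))⁻¹ (fun _ _ => (Rep.update ↥(maximalRealSubfield (HodgeCM.CMField.K F)) (imagUnitSq (HodgeCM.CMField.K F)) (Rep.ofLineOf ↥(maximalRealSubfield (HodgeCM.CMField.K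 F)) (imagUnitSq (HodgeCM.CMField.K F))) (locF ↥(maximalRealSubfield (HodgeCM.CMField.K F)) (imagUnitSq (HodgeCM.CMField.K F)) (realUnit ⟨HodgeCM.CMField.K F⟩ a.1 a.2.1 a.2.2)) (realUnit ⟨HodgeCM.CMField.K F⟩ a.1 a.2.1 a.2.2) rfl))).omega μ₁ h₁ ε₁ χ₁), f ((uniformOmegaRep (Summit.HodgeConjecture.CorCM.DelRec.exists_recordSystem_of_printed hDel) ⟨HodgeCM.CMField.K F⟩ ι₁ ⟨HodgeCM.HermSpace3.Hm V, HodgeCM.HermSpace3.isHermitian V, HodgeCM.HermSpace3.signature_ι₁ V, HodgeCM.HermSpace3.posDef_of_ne V⟩ Φ e₁ (frameD V) (frameD_real V) (frameD_ne V) (ιVE V) (2 * imagUnit (HodgeCM.CMField.K F))⁻¹ (fun _ _ => (Rep.update ↥(maximalRealSubfield (HodgeCM.CMField.K F)) (imagUnitSq (HodgeCM.CMField.K F)) (Rep.ofLineOf ↥(maximalRealSubfield (HodgeCM.CMField.K F)) (imagUnitSq (HodgeCM.CMField.K F))) (locF ↥(maximalRealSubfield (HodgeCM.CMField.K F)) (imagUnitSq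 (HodgeCM.CMField.K F)) (realUnit ⟨HodgeCM.CMField.K F⟩ a.1 a.2.1 a.2.2)) (realUnit ⟨HodgeCM.CMField.K F⟩ a.1 a.2.1 a.2.2) rfl))).rho μ₁ h₁ ε₁ χ₁ g x) = (uniformOmegaRep (Summit.HodgeConjecture.CorCM.DelRec.exists_recordSystem_of_printed hDel) ⟨HodgeCM.CMField.K F⟩ ι₁ ⟨HodgeCM.HermSpace3.Hm V, HodgeCM.HermSpace3.isHermitian V, HodgeCM.HermSpace3.signature_ι₁ V, HodgeCM.HermSpace3.posDef_of_ne V⟩ Φ e₁ (frameD V) (frameD_real V) (frameD_ne V) (ιVE V) (2 * imagUnit (HodgeCM.CMField.K F))⁻¹ (fun _ _ => (Rep.update ↥(maximalRealSubfield (HodgeCM.CMField.K F)) (imagUnitSq (HodgeCM.CMField.K F)) (Rep.ofLineOf ↥(maximalRealSubfield (HodgeCM.CMField.K F)) (imagUnitSq (HodgeCM.CMField.K F))) (locF ↥(maximalRealSubfield (HodgeCM.CMField.K F)) (imagUnitSq (HodgeCM.CMField.K F)) (realUnit ⟨HodgeCM.CMField.K F⟩ a.1 a.2.1 a.2.2))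 (realUnit ⟨HodgeCM.CMField.K F⟩ a.1 a.2.1 a.2.2) rfl))).rho μ₂ h₂ ε₂ χ₂ g (f x)) :
    μ₁ = μ₂ ∧ ε₁ = ε₂ ∧ χ₁ = χ₂ := by
  obtain ⟨hμ, hlines, hχ⟩ := sep_weightOne_at hDel F h6 V a Φ hΦ μ₁ μ₂ h₁ h₂ hw₁ hw₂ ε₁ ε₂ χ₁ χ₂ hs hst
  exact ⟨hμ, (((Rep.update ↥(maximalRealSubfield (HodgeCM.CMField.K F)) (imagUnitSq (HodgeCM.CMField.K F)) (Rep.ofLineOf ↥(maximalRealSubfield (HodgeCM.CMField.K F)) (imagUnitSq (HodgeCM.CMField.K F))) (locF ↥(maximalRealSubfield (HodgeCM.CMField.K F)) (imagUnitSq (HodgeCM.CMField.K F)) (realUnit ⟨HodgeCM.CMField.K F⟩ a.1 a.2.1 a.2.2)) (realUnit ⟨HodgeCM.CMField.K F⟩ a.1 a.2.1 a.2.2) rfl).locF_toFun ε₁ hε₁).symm.trans hlines).trans ((Rep.update ↥(maximalRealSubfield (HodgeCM.CMField.K F)) (imagUnitSq (HodgeCM.CMField.K F)) (Rep.ofLineOf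 ↥(maximalRealSubfield (HodgeCM.CMField.K F)) (imagUnitSq (HodgeCM.CMField.K F))) (locF ↥(maximalRealSubfield (HodgeCM.CMField.K F)) (imagUnitSq (HodgeCM.CMField.K F)) (realUnit ⟨HodgeCM.CMField.K F⟩ a.1 a.2.1 a.2.2)) (realUnit ⟨HodgeCM.CMField.K F⟩ a.1 a.2.1 a.2.2) rfl).locF_toFun ε₂ hε₂), hχ⟩

end Summit.HodgeConjecture.HodgeConjecture.Theorems

end
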